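import Literature.Analysis.FluidPDE.LorentzSpaceRegularityCriteria
import Literature.Analysis.FluidPDE.LorentzBesovEmbedding
import Literature.Analysis.FluidPDE.NSCriticalClosureHolds
import Literature.Analysis.FluidPDE.NSCriticalClosureBesovHolds
import Literature.Analysis.FunctionSpaces.LorentzDiagonal
import HarnessLib

/-!
# Discharge: the Lorentz `L^∞_t L^{3,q}_x` continuation criterion, `3 ≤ q < ∞`

Analysis/FluidPDE proof file: `hasSmoothExtensionPast_of_eLorentzNormPow_bounded_holds` proves the
named fact `hasSmoothExtensionPast_of_eLorentzNormPow_bounded` of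
`LorentzSpaceRegularityCriteria.lean` (Phuc 2015 Thm 1.7 + remark; Lemarié-Rieusset 2nd ed.
Thm 15.6 (b); census `pub/ns-census` row F8′, Lorentz half) from results already in the tree:

* `q = 3`: `L^{3,3} = L³` — `‖u(t)‖³_{L³} = 3 · eLorentzNormPow (u t) 3 3`
  (`FunctionSpaces.eLpNorm_rpow_eq_mul_eLorentzNormPow_self`, layer cake; the slices of a classical
  solution are smooth hence measurable), so the `L³` criterion
  `hasSmoothExtensionPast_of_eLpNorm_three_bounded_holds` (Escauriaza–Seregin–Šverák 2003 /
  Seregin 2012, PROVED in tree) applies;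
* `3 < q < ∞`: the embedding `L^{3,q}(ℝ³) ⊂ Ḃ^{-1+3/q}_{q,q}(ℝ³)`
  (`lorentz_three_subset_homBesov`, PROVED in `LorentzBesovEmbedding.lean`; the sentence of Phuc
  loc. cit. p. 4 comparing his theorem with Gallagher–Koch–Planchon) represents every slice by a
  tempered distribution with `sup_t ‖U t‖_{Ḃ^{-1+3/q}_{q,q}} ≤ C (sup_t eLorentzNormPow (u t) 3 q)^{1/q} < ∞`,
  and the Besov criterion `hasSmoothExtensionPast_of_eHomBesovNorm_bounded_holds`
  (Gallagher–Koch–Planchon 2016 Thm 1, PROVED in tree via Wang–Zhang) applies with `r = q`.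

This is NOT the printed proof (Phuc: `ε`-regularity and backward uniqueness for Leray–Hopf
solutions in `L^{3,q}`; Lemarié-Rieusset: local Leray theory) — for the census frame (classical
solution from a rapidly decaying datum) the embedding route is legitimate and every ingredient is a
theorem of the tree.  The same two steps are recorded census-side as
`Summit.…ScenarioCensus.row_F8pLq_three` / `row_F8pLq_of_lorentzBesov`
(`Summits/…/Theorems/ScenarioCensusForwardLorentz.lean`); they are re-proved here because
Literature does not import Summits.

## References

* N. C. Phuc, J. Math. Fluid Mech. 17 (2015) 741–760 = arXiv:1407.5129, Thm 1.7 and the remark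
  following it (p. 4). [Phuc2015]
* P. G. Lemarié-Rieusset, *The Navier–Stokes Problem in the 21st Century*, 2nd ed., Thm 15.6 (b).
  [LemarieRieusset2023]
* G. Seregin, Comm. Math. Phys. 312 (2012), Thm 1.1; L. Escauriaza, G. Seregin, V. Šverák,
  Russ. Math. Surveys 58 (2003), Thm 1.4. [Seregin2012] [EscauriazaSereginSverak2003]
* I. Gallagher, G. Koch, F. Planchon, Comm. Math. Phys. 343 (2016), Thm 1. [GKP2016]
-/

noncomputable section

open MeasureTheory Set Function Filter
open Literature.Analysis.FunctionSpaces
open scoped ENNReal NNReal Topology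

namespace Literature.Analysis.FluidPDE

/-- The `q = 3` slice: `L^{3,3} = L³` reduces the Lorentz criterion to the `L³` criterion
(Escauriaza–Seregin–Šverák 2003 Thm 1.4 / Seregin 2012 Thm 1.1, in tree).
[cite: Seregin2012, Thm. 1.1 (with EscauriazaSereginSverak2003 Thm. 1.4); Grafakos2014, §1.4.2 (L^{p,p} = L^p)] -/
theorem hasSmoothExtensionPast_of_eLorentzNormPow_three_three_bounded (ν T : ℝ) (hν : 0 < ν)
    (hT : 0 < T) (u : ℝ → EuclideanSpace ℝ (Fin 3) → EuclideanSpace ℝ (Fin 3))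
    (p : ℝ → EuclideanSpace ℝ (Fin 3) → ℝ) (hcl : IsClassicalNSSolutionOn (Ico 0 T) ν 0 u p)
    (hLH : IsLerayHopfOn T ν 0 (u 0) u) (hdec : HasRapidSpatialDecay (u 0))
    (hsup : (⨆ t ∈ Ico 0 T, eLorentzNormPow (u t) 3 3 volume) < ⊤) :
    HasSmoothExtensionPast ν 0 u T := by
  refine hasSmoothExtensionPast_of_eLpNorm_three_bounded_holds ν T hν hT u p hcl hLH hdec ?_
  set M := ⨆ t ∈ Ico (0 : ℝ) T, eLorentzNormPow (u t) 3 3 volume with hM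
  have h3 : (3 : ℝ≥0∞) ≠ 0 := by norm_num
  have h3' : (3 : ℝ≥0∞) ≠ ⊤ := ENNReal.ofNat_ne_top
  have hbound : ∀ t ∈ Ico (0 : ℝ) T,
      eLpNorm (u t) 3 volume ≤ (ENNReal.ofReal 3 * M) ^ (1 / (3 : ℝ)) := by
    intro t ht
    have hmeas : AEStronglyMeasurable (u t) volume :=
      (hcl.contDiff_velocity ht).continuous.aestronglyMeasurable
    have hle : eLorentzNormPow (u t) 3 3 volume ≤ M :=
      le_iSup₂ (f := fun t (_ : t ∈ Ico (0 : ℝ) T) => eLorentzNormPow (u t) 3 3 volume) t ht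
    have hpow : eLpNorm (u t) 3 volume ^ (3 : ℝ) ≤ ENNReal.ofReal 3 * M := by
      have h := eLpNorm_rpow_eq_mul_eLorentzNormPow_self (μ := volume) hmeas h3 h3'
      rw [ENNReal.toReal_ofNat] at h
      rw [h]
      exact mul_le_mul_right hle (ENNReal.ofReal 3)
    calc eLpNorm (u t) 3 volume
        = (eLpNorm (u t) 3 volume ^ (3 : ℝ)) ^ (1 / (3 : ℝ)) := by
          rw [← ENNReal.rpow_mul]; norm_num
      _ ≤ (ENNReal.ofReal 3 * M) ^ (1 / (3 : ℝ)) := by gcongr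
  calc (⨆ t ∈ Ico (0 : ℝ) T, eLpNorm (u t) 3 volume)
      ≤ (ENNReal.ofReal 3 * M) ^ (1 / (3 : ℝ)) := iSup₂_le hbound
    _ < ⊤ := ENNReal.rpow_lt_top_of_nonneg (by norm_num)
        (ENNReal.mul_ne_top ENNReal.ofReal_ne_top hsup.ne)

/-- The slices `3 < q < ∞`: the embedding `L^{3,q} ⊂ Ḃ^{-1+3/q}_{q,q}`
(`lorentz_three_subset_homBesov`) reduces the Lorentz criterion to the critical Besov criterion
(Gallagher–Koch–Planchon 2016 Thm 1, in tree) at `r = q`.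
[cite: GKP2016, Thm. 1; Phuc2015, remark following Thm. 1.7 (arXiv:1407.5129 p. 4)] -/
theorem hasSmoothExtensionPast_of_eLorentzNormPow_bounded_of_three_lt (ν T : ℝ) (hν : 0 < ν)
    (hT : 0 < T) (u : ℝ → EuclideanSpace ℝ (Fin 3) → EuclideanSpace ℝ (Fin 3))
    (p : ℝ → EuclideanSpace ℝ (Fin 3) → ℝ) (q : ℝ≥0∞) (h3q : 3 < q) (hqtop : q < ⊤)
    (hcl : IsClassicalNSSolutionOn (Ico 0 T) ν 0 u p) (hLH : IsLerayHopfOn T ν 0 (u 0) u)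
    (hdec : HasRapidSpatialDecay (u 0))
    (hsup : (⨆ t ∈ Ico 0 T, eLorentzNormPow (u t) 3 q volume) < ⊤) :
    HasSmoothExtensionPast ν 0 u T := by
  classical
  haveI : Fact (1 ≤ q) := ⟨le_trans (by norm_num) h3q.le⟩
  have h1q : 1 ≤ q := le_trans (by norm_num) h3q.le
  obtain ⟨C, hC, hemb⟩ := lorentz_three_subset_homBesov (ι := Fin 3) q q h3q hqtop h1q hqtop
  set M := ⨆ t ∈ Ico (0 : ℝ) T, eLorentzNormPow (u t) 3 q volume with hM
  have hle : ∀ t ∈ Ico (0 : ℝ) T, eLorentzNormPow (u t) 3 q volume ≤ M := fun t ht =>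
    le_iSup₂ (f := fun t (_ : t ∈ Ico (0 : ℝ) T) => eLorentzNormPow (u t) 3 q volume) t ht
  have hfin : ∀ t ∈ Ico (0 : ℝ) T, eLorentzNormPow (u t) 3 q volume < ⊤ := fun t ht =>
    lt_of_le_of_lt (hle t ht) hsup
  have hmeas : ∀ t ∈ Ico (0 : ℝ) T, AEStronglyMeasurable (u t) volume := fun t ht =>
    (hcl.contDiff_velocity ht).continuous.aestronglyMeasurable
  let U : ℝ → TemperedDistribution (EuclideanSpace ℝ (Fin 3)) (EuclideanSpace ℂ (Fin 3)) :=
    fun t => if ht : t ∈ Ico (0 : ℝ) T then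
      Classical.choose (hemb (u t) (hmeas t ht) (hfin t ht)) else 0
  have hU : ∀ t (ht : t ∈ Ico (0 : ℝ) T), IsDistributionOf (u t) (U t) ∧
      eHomBesovNorm (-1 + 3 / q.toReal) q q (U t) ≤
        C * eLorentzNormPow (u t) 3 q volume ^ (1 / q.toReal) := by
    intro t ht
    have h := Classical.choose_spec (hemb (u t) (hmeas t ht) (hfin t ht))
    simp only [U, dif_pos ht]
    exact h
  refine hasSmoothExtensionPast_of_eHomBesovNorm_bounded_holds ν T hν hT u p U q q h3q hqtop
    h3q hqtop hcl hLH hdec (fun t ht => (hU t ht).1) ?_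
  calc (⨆ t ∈ Ico (0 : ℝ) T, eHomBesovNorm (-1 + 3 / q.toReal) q q (U t))
      ≤ C * M ^ (1 / q.toReal) := by
        refine iSup₂_le fun t ht => le_trans (hU t ht).2 ?_
        gcongr
        exact hle t ht
    _ < ⊤ := ENNReal.mul_lt_top hC
        (ENNReal.rpow_lt_top_of_nonneg (by positivity) hsup.ne)

/-- **Discharge of `hasSmoothExtensionPast_of_eLorentzNormPow_bounded`** (Phuc 2015 Thm 1.7 +
remark; Lemarié-Rieusset Thm 15.6 (b); census row F8′, Lorentz half): a classical solution on
`ℝ³ × [0,T)`, Leray–Hopf from a rapidly decaying datum, with `sup_t eLorentzNormPow (u t) 3 q < ∞`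
for some `3 ≤ q < ∞`, extends past `T`.  `q = 3` by the `L³` criterion (`L^{3,3} = L³`), `q > 3`
by `L^{3,q} ⊂ Ḃ^{-1+3/q}_{q,q}` and the Besov criterion — all PROVED in tree.
[cite: Phuc2015, Thm. 1.7 and the remark following it (arXiv:1407.5129 p. 4)] -/
theorem hasSmoothExtensionPast_of_eLorentzNormPow_bounded_holds :
    hasSmoothExtensionPast_of_eLorentzNormPow_bounded := by
  intro ν T hν hT u p q h3q hqtop hcl hLH hdec hsup
  rcases eq_or_lt_of_le h3q with h3 | h3
  · subst h3
    exact hasSmoothExtensionPast_of_eLorentzNormPow_three_three_bounded ν T hν hT u p hcl hLH hdec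
      hsup
  · exact hasSmoothExtensionPast_of_eLorentzNormPow_bounded_of_three_lt ν T hν hT u p q h3 hqtop
      hcl hLH hdec hsup

end Literature.Analysis.FluidPDE

end
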